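import Literature.Algebra.EuclideanLattices.LLLMachineTables
import Literature.Algebra.EuclideanLattices.GapSVPVerifier
import Literature.Computability.Complexity.FoldBricks
import Literature.Computability.Complexity.ListFoldChecks
import Literature.Computability.Complexity.IntMatrixBricks
import HarnessLib

/-!
# The verifier machine of the integer coNP certificate for `GapCVP`, I: index lists, normalisation of witness matrices, readers of the instance

Topic `Algebra/EuclideanLattices` (family `pqc`). First of two files realising the verifier of the
integer far-ness certificate `FarCert` (`GapCVPCoNPWitness.lean`; Aharonov–Regev 2005, Thm. 1.1, coNP
part, §6) as a polynomial-time string function, towards the named fact `FarCert.verifier_mem_P`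
(AR05 p. 10: "It is easy to see that the verifier can be implemented in polynomial time"). Written in
the tree's `FP` string algebra in the style of `LLLMachineTables.lean` (`rowCode`/`matCode`, `dotF`,
`mapLF`, `nthLF`, `colF` of `ListBricks.lean`; `foldLoop` of `FoldBricks.lean`; `foldFn`/`allFn` of
`ListFoldBricks.lean`): no Turing machine by hand; every routine is a composition of total string
functions with an `_apply` lemma on genuine codes and an output bound valid on every input.

The verifier must be analysable on ARBITRARY witness strings (clause (ii) of `verifier_mem_P`: every
accepted string denotes some accepted certificate). This file provides the TOTAL front end:

* `iotaF` / `idxList k = encList [1⁰, …, 1ᵏ⁻¹]` — the list of unary indices (indexed fold with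
  concatenation), so that maps over index ranges are `mapLF` over `idxList` (`mapLF_idxList`);
  `lenListF` — the number of items of a coded list, in binary;
* `normRowF`, `normMatF` — **normalisation**: the canonical code (`rowCode`, `matCode`) of the integer
  vector / matrix `(i, j) ↦ ival ((w[i])[j])` read off an arbitrary string `w` by the total accessor
  `elemOf` (missing items read `0`), entries capped at width `|x|` by `zcapF` so that the item functions
  have absolutely bounded output (the cap is inactive on data read off the input,
  `capZ_ival_elemOf`);
* `bMatF` (`bMatF_rowMajor`: `matCode B` from the row-major sign–magnitude entry list of the instance,
  index arithmetic `i n + k` in binary and a ruler-capped conversion to unary) and `tRowF`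
  (`tRowF_frames`: `rowCode t` from the framed code of the target).

## References

* D. Aharonov, O. Regev, *Lattice problems in NP ∩ coNP*, J. ACM 52 (2005) 749–765, §6 (p. 10).
* S. Arora, B. Barak, *Computational Complexity: A Modern Approach*, CUP 2009, §1.3 (polynomial time
  is closed under composition and bounded loops), §0.1 (codes of tuples and lists).
-/

namespace Literature.Algebra.EuclideanLattices

open _root_.Computability Literature.Computability.Complexity Literature.Computability.Complexity.Brick Polynomial
open LLLMachine PRelSigPi OracleCompose GMSS

namespace FarCertMachine

/-! ### Codes: `body = encList`, access by `elemOf`, snoc -/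

/-- `elemOf` on a coded list is list access with default `ε` (the codings `body` and `encList` agree,
cf. `frames_eq_encList`). [folklore] -/
theorem elemOf_encList (L : List (List Bool)) (i : ℕ) : elemOf (encList L) i = L.getD i [] := by
  have h : ∀ l : List (List Bool), body l = encList l := fun l => by
    induction l with
    | nil => rfl
    | cons a l ih => rw [body_cons, encList_cons, ih]
  rw [← h, elemOf_body]

/-- A pair is its first component paired with `ε`, followed by the second. [folklore] -/
theorem boolPair_eq_append (a b : List Bool) : boolPair a b = boolPair a [] ++ b := by
  simp [boolPair]

/-- Snoc on coded lists is concatenation. [folklore] -/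
theorem encList_append_singleton (L : List (List Bool)) (a : List Bool) :
    encList (L ++ [a]) = encList L ++ boolPair a [] := by
  induction L with
  | nil => simp [encList]
  | cons b L ih => rw [List.cons_append, encList_cons, encList_cons, ih, boolPair_eq_append b (encList L),
      boolPair_eq_append b (encList L ++ _), List.append_assoc]

/-- A concatenation of singleton-coded pieces is a coded list. [folklore] -/
theorem ccat_boolPair_nil (g : ℕ → List Bool) : ∀ k : ℕ, ccat (fun j => boolPair (g j) []) k = encList ((List.range k).map g)
  | 0 => by simp
  | k + 1 => by rw [ccat_succ, ccat_boolPair_nil g k, List.range_succ, List.map_append, List.map_singleton,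
      encList_append_singleton]

/-! ### The index list `[1⁰, 1¹, …, 1ᵏ⁻¹]` -/

/-- The piece function of the index list: `⟨x, 1ʲ⟩ ↦ ⟨1ʲ, ε⟩`. [folklore] -/
noncomputable def iotaPiece : List Bool → List Bool := fanoutFn sndF (fun _ => [])

/-- `iotaPiece ∈ FP`. [folklore] -/
theorem iotaPiece_mem_FP : iotaPiece ∈ FP := fanoutFn_mem_FP sndF_mem_FP (const_mem_FP [])

/-- The code of the list of unary indices below `k`. [folklore] -/
def idxList (k : ℕ) : List Bool := encList ((List.range k).map ones)

/-- **The index list** on `⟨x, bin k⟩` (`k ≤ |x|`): `encList [1⁰, …, 1ᵏ⁻¹]`, by the indexed fold with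
concatenation (`FoldBricks.foldLoop appF`). [folklore] -/
noncomputable def iotaF : List Bool → List Bool :=
  sndPow 2 ∘ foldLoop appF (clipF 2 iotaPiece) X ∘ fanoutFn fstF (fanoutFn sndF (fun _ => boolPair [] []))

/-- `iotaF ∈ FP`. [folklore] -/
theorem iotaF_mem_FP : iotaF ∈ FP :=
  comp_mem_FP (sndPow_mem_FP 2) (comp_mem_FP (foldLoop_clipF_mem_FP 2 appF_mem_FP length_appF_le iotaPiece_mem_FP X)
    (fanoutFn_mem_FP fstF_mem_FP (fanoutFn_mem_FP sndF_mem_FP (const_mem_FP _))))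

/-- **Semantics of `iotaF`** (`k ≤ |x|`). [folklore] -/
theorem iotaF_apply (x : List Bool) {k : ℕ} (hk : k ≤ x.length) : iotaF (boolPair x (encodeNat k)) = idxList k := by
  have h0 : boolPair [] [] = boolPair (ones 0) [] := rfl
  simp only [iotaF, Function.comp_apply, fanoutFn_apply, fstF_boolPair, sndF_boolPair]
  rw [h0, foldLoop_apply _ _ (by simpa using hk), sndPow_succ_boolPair, sndPow_succ_boolPair, sndPow_zero_boolPair,
    foldAcc_clipF (fun j _ hj => by simp [iotaPiece, ones]; omega), foldAcc_appF, List.nil_append, idxList,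
    ccat_congr (g' := fun j => boolPair (ones j) []) (fun j _ => by simp [iotaPiece])]
  exact ccat_boolPair_nil ones k

/-- Items of the index list. [folklore] -/
theorem decNil_idxList (k : ℕ) : decNil (idxList k) = (List.range k).map ones := by
  rw [idxList, decNil_encList]

/-- Length of the index list: `∑ (2j + 2) ≤ …`; the crude bound `≤ k (2k + 2)`. [folklore] -/
theorem length_idxList_le (k : ℕ) : (idxList k).length ≤ k * (2 * k + 2) := by
  induction k with
  | zero => simp [idxList]
  | succ k ih =>
    rw [idxList, List.range_succ, List.map_append, List.map_singleton, encList_append_singleton, List.length_append,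
      length_boolPair, ← idxList]
    simp only [List.length_replicate, List.length_nil]
    nlinarith

/-! ### The number of items of a coded list, in binary -/

/-- The counting step `acc ↦ acc + 1`. [folklore] -/
noncomputable def cntStep : List Bool → List Bool := addFn ∘ fanoutFn (sndPow 1) (fun _ => [true])

/-- `cntStep ∈ FP`. [folklore] -/
theorem cntStep_mem_FP : cntStep ∈ FP := comp_mem_FP addFn_mem_FP (fanoutFn_mem_FP (sndPow_mem_FP 1) (const_mem_FP _))

/-- Value of the counting step. [folklore] -/
theorem cntStep_apply (w a acc : List Bool) : cntStep (boolPair w (boolPair a acc)) = encodeNat (bitsToNat acc + 1) := by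
  simp [cntStep]

/-- Growth of the counting step. [folklore] -/
theorem foldGrowth_cntStep : FoldGrowth 2 cntStep := fun v => by
  rw [cntStep, Function.comp_apply, fanoutFn_apply]
  have h := length_addFn_le (boolPair (sndPow 1 v) [true])
  simp only [fstF_boolPair, sndF_boolPair, List.length_singleton] at h
  have e : sndPow 1 v = sndF (sndF v) := rfl
  rw [e] at h ⊢
  omega

/-- The fold of the counting step counts. [folklore] -/
theorem foldl_cntStep (w : List Bool) : ∀ (l : List (List Bool)) (k : ℕ),
    l.foldl (fun acc a => cntStep (boolPair w (boolPair a acc))) (encodeNat k) = encodeNat (k + l.length)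
  | [], k => by simp
  | a :: l, k => by
    rw [List.foldl_cons, cntStep_apply, bitsToNat_encodeNat, foldl_cntStep w l (k + 1), List.length_cons]
    congr 1; omega

/-- **The number of items** of the coded list `L` on `⟨x, L⟩`, in binary: `bin |decNil L|`. [folklore] -/
noncomputable def lenListF : List Bool → List Bool := foldFn cntStep (fun _ => [])

/-- `lenListF ∈ FP`. [folklore] -/
theorem lenListF_mem_FP : lenListF ∈ FP := foldFn_mem_FP cntStep_mem_FP (const_mem_FP _) foldGrowth_cntStep

/-- Semantics of `lenListF`. [folklore] -/
theorem lenListF_boolPair (x L : List Bool) : lenListF (boolPair x L) = encodeNat (decNil L).length := by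
  rw [lenListF, foldFn_boolPair, show ([] : List Bool) = encodeNat 0 from rfl, foldl_cntStep, Nat.zero_add]


/-! ### Reading integers off arbitrary strings: the capped canonical code of `ival (elemOf v j)` -/

/-- The integer denoted by a string is below `2^{length}` in absolute value. [folklore] -/
theorem natAbs_ival_lt (u : List Bool) : (ival u).natAbs < 2 ^ u.length := by
  have h1 := bitsToNat_lt (fstF u)
  have h2 := bitsToNat_lt (sndF u)
  have h3 := length_fstF_sndF_le u
  have h4 : 2 ^ (fstF u).length ≤ 2 ^ u.length := Nat.pow_le_pow_right (by norm_num) (by omega)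
  have h5 : 2 ^ (sndF u).length ≤ 2 ^ u.length := Nat.pow_le_pow_right (by norm_num) (by omega)
  rw [ival]
  omega

/-- The cap at width `|x|` is inactive on integers read off substrings of `x`-short strings. [folklore] -/
theorem capZ_ival_elemOf {x v : List Bool} (hv : v.length ≤ x.length) (j : ℕ) :
    capZ x.length (ival (elemOf v j)) = ival (elemOf v j) :=
  capZ_of_lt (lt_of_lt_of_le (natAbs_ival_lt _)
    (Nat.pow_le_pow_right (by norm_num) ((length_elemOf_le v j).trans hv)))

/-- The item function of row normalisation on `⟨x, ⟨v, a⟩⟩`: the capped canonical code of the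
`|a|`-th integer of `v`. [folklore] -/
noncomputable def nrItem : List Bool → List Bool :=
  zcapF ∘ fanoutFn (nthF 0) (zcanonF ∘ elemFn ∘ fanoutFn (sndPow 1) (nthF 1))

/-- `nrItem ∈ FP`. [folklore] -/
theorem nrItem_mem_FP : nrItem ∈ FP :=
  comp_mem_FP zcapF_mem_FP (fanoutFn_mem_FP (nthF_mem_FP 0) (comp_mem_FP zcanonF_mem_FP (comp_mem_FP elemFn_mem_FP
    (fanoutFn_mem_FP (sndPow_mem_FP 1) (nthF_mem_FP 1)))))

/-- Semantics of `nrItem`. [folklore] -/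
theorem nrItem_apply (x v a : List Bool) :
    nrItem (boolPair x (boolPair v a)) = dpEnc (capZ x.length (ival (elemOf v a.length))) := by
  simp only [nrItem, Function.comp_apply, fanoutFn_apply, nthF_zero_boolPair, nthF_succ_boolPair, sndPow_succ_boolPair,
    sndPow_zero, sndF_boolPair, elemFn_boolPair, zcanonF_eq]
  rw [zcapF_dpEnc, capZ]

/-- `nrItem` saturates: `≤ 2|x| + 2` on every input. [folklore] -/
theorem length_nrItem_le (x p a : List Bool) :
    (nrItem (boolPair x (boolPair p a))).length ≤ 0 * a.length + (2 * X + 2 : Polynomial ℕ).eval x.length := by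
  have := length_zcapF_le (boolPair x (zcanonF (elemFn (boolPair a p))))
  simp only [nrItem, Function.comp_apply, fanoutFn_apply, nthF_zero_boolPair, nthF_succ_boolPair, sndPow_succ_boolPair,
    sndPow_zero, sndF_boolPair, fstF_boolPair, eval_add, eval_mul, eval_ofNat, eval_X, zero_mul, zero_add] at this ⊢
  exact this

/-- **Row normalisation** on `⟨x, ⟨bin m, ⟨v, idxList m⟩⟩⟩`: the canonical code of the integer
`m`-vector `(ival v[0], …, ival v[m-1])` read off an ARBITRARY string `v` (entries by `elemOf`,
missing ones `0`, values capped at width `|x|`). [folklore] -/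
noncomputable def normRowF : List Bool → List Bool := mapLF nrItem

/-- `normRowF ∈ FP`. [folklore] -/
theorem normRowF_mem_FP : normRowF ∈ FP := mapLF_mem_FP nrItem_mem_FP (w := 0) (by norm_num) length_nrItem_le

/-- `List.ofFn` over `Fin m` as a map over `range m`. [folklore] -/
theorem ofFn_eq_map_range {α : Type*} {m : ℕ} (f : ℕ → α) : (List.ofFn fun j : Fin m => f j) = (List.range m).map f := by
  apply List.ext_getElem (by simp)
  intro i h₁ h₂
  simp

/-- **`mapLF` over the index list** (`k ≤ |x|`): the images of `⟨x, ⟨prm, 1ʲ⟩⟩`, `j < k`. [folklore] -/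
theorem mapLF_idxList (f : List Bool → List Bool) (x prm : List Bool) {k : ℕ} (hk : k ≤ x.length) :
    mapLF f (boolPair x (boolPair (encodeNat k) (boolPair prm (idxList k)))) =
      encList ((List.range k).map fun j => f (boolPair x (boolPair prm (ones j)))) := by
  rw [idxList, mapLF_apply _ _ _ hk, List.take_of_length_le (by simp), List.map_map]
  rfl

/-- `rowCode` as a map over `range`. [folklore] -/
theorem rowCode_eq_map_range {m : ℕ} (v : Fin m → ℤ) (f : ℕ → ℤ) (hf : ∀ j : Fin m, v j = f j) :
    rowCode v = encList ((List.range m).map fun j => dpEnc (f j)) := by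
  rw [rowCode, zlist_eq, show (List.ofFn v) = List.ofFn (fun j : Fin m => f j) from congrArg List.ofFn (funext hf),
    ofFn_eq_map_range f, List.map_map]
  rfl

/-- **Semantics of `normRowF`** (`m ≤ |x|`). [folklore] -/
theorem normRowF_apply (x : List Bool) {m : ℕ} (hm : m ≤ x.length) (v : List Bool) :
    normRowF (boolPair x (boolPair (encodeNat m) (boolPair v (idxList m)))) =
      rowCode (fun j : Fin m => capZ x.length (ival (elemOf v j))) := by
  rw [normRowF, mapLF_idxList _ _ _ hm, rowCode_eq_map_range _ (fun j => capZ x.length (ival (elemOf v j))) (fun j => rfl)]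
  refine congrArg encList (List.map_congr_left fun j _ => ?_)
  rw [nrItem_apply, List.length_replicate]

/-- Length of `normRowF`: absolute, `≤ |x|(4|x| + 8)`. [folklore] -/
theorem length_normRowF_le (z : List Bool) : (normRowF z).length ≤ (fstF z).length * (4 * (fstF z).length + 8) := by
  have h := length_mapLF_le (f := nrItem) 0 (P := 2 * X + 2) length_nrItem_le z
  simp only [zero_mul, zero_add, eval_add, eval_mul, eval_ofNat, eval_X] at h
  rw [normRowF]
  nlinarith

/-- The item function of matrix normalisation on `⟨x, ⟨⟨bin m, ⟨idx, w⟩⟩, a⟩⟩`: the normalised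
`|a|`-th row of `w`. [folklore] -/
noncomputable def nmItem : List Bool → List Bool :=
  normRowF ∘ fanoutFn (nthF 0) (fanoutFn (fstF ∘ nthF 1)
    (fanoutFn (elemFn ∘ fanoutFn (sndPow 1) (sndF ∘ sndF ∘ nthF 1)) (fstF ∘ sndF ∘ nthF 1)))

/-- `nmItem ∈ FP`. [folklore] -/
theorem nmItem_mem_FP : nmItem ∈ FP :=
  comp_mem_FP normRowF_mem_FP (fanoutFn_mem_FP (nthF_mem_FP 0) (fanoutFn_mem_FP (comp_mem_FP fstF_mem_FP (nthF_mem_FP 1))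
    (fanoutFn_mem_FP (comp_mem_FP elemFn_mem_FP (fanoutFn_mem_FP (sndPow_mem_FP 1)
      (comp_mem_FP sndF_mem_FP (comp_mem_FP sndF_mem_FP (nthF_mem_FP 1))))) (comp_mem_FP fstF_mem_FP (comp_mem_FP sndF_mem_FP (nthF_mem_FP 1))))))

/-- Semantics of `nmItem`. [folklore] -/
theorem nmItem_apply (x : List Bool) {m : ℕ} (hm : m ≤ x.length) (w a : List Bool) :
    nmItem (boolPair x (boolPair (boolPair (encodeNat m) (boolPair (idxList m) w)) a)) =
      rowCode (fun j : Fin m => capZ x.length (ival (elemOf (elemOf w a.length) j))) := by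
  simp only [nmItem, Function.comp_apply, fanoutFn_apply, nthF_zero_boolPair, nthF_succ_boolPair, sndPow_succ_boolPair,
    sndPow_zero, sndF_boolPair, fstF_boolPair, elemFn_boolPair]
  exact normRowF_apply x hm _

/-- `nmItem` has absolutely bounded output. [folklore] -/
theorem length_nmItem_le (x p a : List Bool) :
    (nmItem (boolPair x (boolPair p a))).length ≤ 0 * a.length + (X * (4 * X + 8) : Polynomial ℕ).eval x.length := by
  have := length_normRowF_le (boolPair x (boolPair (fstF p) (boolPair (elemFn (boolPair a (sndF (sndF p)))) (fstF (sndF p)))))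
  simp only [nmItem, Function.comp_apply, fanoutFn_apply, nthF_zero_boolPair, nthF_succ_boolPair, sndPow_succ_boolPair,
    sndPow_zero, sndF_boolPair, fstF_boolPair, eval_add, eval_mul, eval_ofNat, eval_X, zero_mul, zero_add] at this ⊢
  exact this

/-- **Matrix normalisation** on `⟨x, ⟨bin n', ⟨⟨bin m, ⟨idxList m, w⟩⟩, idxList n'⟩⟩⟩`: the canonical
code (`matCode`) of the integer `n' × m` matrix `(i, j) ↦ ival (w[i])[j]` read off an ARBITRARY
string `w`. [folklore] -/
noncomputable def normMatF : List Bool → List Bool := mapLF nmItem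

/-- `normMatF ∈ FP`. [folklore] -/
theorem normMatF_mem_FP : normMatF ∈ FP := mapLF_mem_FP nmItem_mem_FP (w := 0) (by norm_num) length_nmItem_le

/-- **Semantics of `normMatF`** (`n', m ≤ |x|`). [folklore] -/
theorem normMatF_apply (x : List Bool) {n' m : ℕ} (hn : n' ≤ x.length) (hm : m ≤ x.length) (w : List Bool) :
    normMatF (boolPair x (boolPair (encodeNat n') (boolPair (boolPair (encodeNat m) (boolPair (idxList m) w)) (idxList n')))) =
      matCode (fun (i : Fin n') (j : Fin m) => capZ x.length (ival (elemOf (elemOf w i) j))) := by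
  rw [normMatF, mapLF_idxList _ _ _ hn, matCode,
    ofFn_eq_map_range (fun i => rowCode fun j : Fin m => capZ x.length (ival (elemOf (elemOf w i) j)))]
  refine congrArg encList (List.map_congr_left fun i _ => ?_)
  rw [nmItem_apply x hm, List.length_replicate]

/-- Length of `normMatF`: absolute, `≤ |x|(2|x|(4|x| + 8) + 4)`. [folklore] -/
theorem length_normMatF_le (z : List Bool) :
    (normMatF z).length ≤ (fstF z).length * (2 * ((fstF z).length * (4 * (fstF z).length + 8)) + 4) := by
  have h := length_mapLF_le (f := nmItem) 0 (P := X * (4 * X + 8)) length_nmItem_le z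
  simp only [zero_mul, zero_add, eval_add, eval_mul, eval_ofNat, eval_X] at h
  rw [normMatF]
  exact h


/-! ### Reading the instance: the basis `B` (row-major sign–magnitude codes) and the target `t` -/

/-- The cap is inactive on sign–magnitude values read off `x`-short strings. [folklore] -/
theorem natAbs_smval_lt (e : List Bool) : (smval e).natAbs < 2 ^ e.length := by
  have h2 := bitsToNat_lt (sndF e)
  have h3 := length_fstF_sndF_le e
  have h5 : 2 ^ (sndF e).length ≤ 2 ^ e.length := Nat.pow_le_pow_right (by norm_num) (by omega)
  rw [smval]; split_ifs <;> simp <;> omega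

/-- The cap at width `|x|` is inactive on `smval (elemOf v j)` for `|v| ≤ |x|`. [folklore] -/
theorem capZ_smval_elemOf {x v : List Bool} (hv : v.length ≤ x.length) (j : ℕ) :
    capZ x.length (smval (elemOf v j)) = smval (elemOf v j) :=
  capZ_of_lt (lt_of_lt_of_le (natAbs_smval_lt _) (Nat.pow_le_pow_right (by norm_num) ((length_elemOf_le v j).trans hv)))

/-- The index `1^{min (i n + k) |x|}` on `⟨x, ⟨⟨1ⁱ, ⟨bin n, ents⟩⟩, 1ᵏ⟩⟩` (binary arithmetic, then a
ruler-capped conversion to unary). [folklore] -/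
noncomputable def bIdxF : List Bool → List Bool :=
  binToUnaryFn ∘ fanoutFn (nthF 0) (addFn ∘ fanoutFn
    (prodFn ∘ fanoutFn (lenBinF ∘ fstF ∘ nthF 1) (fstF ∘ sndF ∘ nthF 1)) (lenBinF ∘ sndPow 1))

/-- `bIdxF ∈ FP`. [folklore] -/
theorem bIdxF_mem_FP : bIdxF ∈ FP :=
  comp_mem_FP binToUnaryFn_mem_FP (fanoutFn_mem_FP (nthF_mem_FP 0) (comp_mem_FP addFn_mem_FP (fanoutFn_mem_FP
    (comp_mem_FP prodFn_mem_FP (fanoutFn_mem_FP (comp_mem_FP lenBinF_mem_FP (comp_mem_FP fstF_mem_FP (nthF_mem_FP 1)))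
      (comp_mem_FP fstF_mem_FP (comp_mem_FP sndF_mem_FP (nthF_mem_FP 1)))))
    (comp_mem_FP lenBinF_mem_FP (sndPow_mem_FP 1)))))

/-- Value of `bIdxF`. [folklore] -/
theorem bIdxF_apply (x ents : List Bool) (i n k : ℕ) :
    bIdxF (boolPair x (boolPair (boolPair (ones i) (boolPair (encodeNat n) ents)) (ones k))) = ones (min (i * n + k) x.length) := by
  simp [bIdxF, ones]

/-- The entry item of the basis reader on `⟨x, ⟨⟨1ⁱ, ⟨bin n, ents⟩⟩, 1ᵏ⟩⟩`: the capped canonical code of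
`smval ents[i n + k]`. [folklore] -/
noncomputable def bItem : List Bool → List Bool :=
  zcapF ∘ fanoutFn (nthF 0) (zcanonF ∘ ofSMFn ∘ elemFn ∘ fanoutFn bIdxF (sndF ∘ sndF ∘ nthF 1))

/-- `bItem ∈ FP`. [folklore] -/
theorem bItem_mem_FP : bItem ∈ FP :=
  comp_mem_FP zcapF_mem_FP (fanoutFn_mem_FP (nthF_mem_FP 0) (comp_mem_FP zcanonF_mem_FP (comp_mem_FP ofSMFn_mem_FP
    (comp_mem_FP elemFn_mem_FP (fanoutFn_mem_FP bIdxF_mem_FP (comp_mem_FP sndF_mem_FP (comp_mem_FP sndF_mem_FP (nthF_mem_FP 1))))))))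

/-- Semantics of `bItem`. [folklore] -/
theorem bItem_apply (x ents : List Bool) (i n k : ℕ) :
    bItem (boolPair x (boolPair (boolPair (ones i) (boolPair (encodeNat n) ents)) (ones k))) =
      dpEnc (capZ x.length (smval (elemOf ents (min (i * n + k) x.length)))) := by
  rw [bItem, Function.comp_apply, fanoutFn_apply, Function.comp_apply, Function.comp_apply, Function.comp_apply,
    fanoutFn_apply, bIdxF_apply]
  simp only [nthF_zero_boolPair, Function.comp_apply, nthF_succ_boolPair, sndF_boolPair, elemFn_boolPair, zcanonF_eq,
    ival_ofSMFn, List.length_replicate]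
  rw [zcapF_dpEnc, capZ]

/-- `bItem` saturates: `≤ 2|x| + 2`. [folklore] -/
theorem length_bItem_le (x p a : List Bool) :
    (bItem (boolPair x (boolPair p a))).length ≤ 0 * a.length + (2 * X + 2 : Polynomial ℕ).eval x.length := by
  have := length_zcapF_le (boolPair x (zcanonF (ofSMFn (elemFn (boolPair (bIdxF (boolPair x (boolPair p a))) (sndF (sndF p)))))))
  simp only [bItem, Function.comp_apply, fanoutFn_apply, nthF_zero_boolPair, nthF_succ_boolPair, fstF_boolPair,
    eval_add, eval_mul, eval_ofNat, eval_X, zero_mul, zero_add] at this ⊢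
  exact this

/-- **A row of the basis** on `⟨x, ⟨bin n, ⟨⟨1ⁱ, ⟨bin n, ents⟩⟩, idxList n⟩⟩⟩`. [folklore] -/
noncomputable def bRowF : List Bool → List Bool := mapLF bItem

/-- `bRowF ∈ FP`. [folklore] -/
theorem bRowF_mem_FP : bRowF ∈ FP := mapLF_mem_FP bItem_mem_FP (w := 0) (by norm_num) length_bItem_le

/-- Semantics of `bRowF` (`n ≤ |x|`). [folklore] -/
theorem bRowF_apply (x : List Bool) {n : ℕ} (hn : n ≤ x.length) (ents : List Bool) (i : ℕ) :
    bRowF (boolPair x (boolPair (encodeNat n) (boolPair (boolPair (ones i) (boolPair (encodeNat n) ents)) (idxList n)))) =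
      rowCode (fun k : Fin n => capZ x.length (smval (elemOf ents (min (i * n + k) x.length)))) := by
  rw [bRowF, mapLF_idxList _ _ _ hn,
    rowCode_eq_map_range _ (fun k => capZ x.length (smval (elemOf ents (min (i * n + k) x.length)))) (fun k => rfl)]
  refine congrArg encList (List.map_congr_left fun k _ => ?_)
  rw [bItem_apply]

/-- Length of `bRowF`: absolute, `≤ |x|(4|x| + 8)`. [folklore] -/
theorem length_bRowF_le (z : List Bool) : (bRowF z).length ≤ (fstF z).length * (4 * (fstF z).length + 8) := by
  have h := length_mapLF_le (f := bItem) 0 (P := 2 * X + 2) length_bItem_le z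
  simp only [zero_mul, zero_add, eval_add, eval_mul, eval_ofNat, eval_X] at h
  rw [bRowF]
  nlinarith

/-- The row item of the basis reader on `⟨x, ⟨⟨bin n, ⟨ents, idx⟩⟩, 1ⁱ⟩⟩`. [folklore] -/
noncomputable def bRowItem : List Bool → List Bool :=
  bRowF ∘ fanoutFn (nthF 0) (fanoutFn (fstF ∘ nthF 1)
    (fanoutFn (fanoutFn (sndPow 1) (fanoutFn (fstF ∘ nthF 1) (fstF ∘ sndF ∘ nthF 1))) (sndF ∘ sndF ∘ nthF 1)))

/-- `bRowItem ∈ FP`. [folklore] -/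
theorem bRowItem_mem_FP : bRowItem ∈ FP :=
  comp_mem_FP bRowF_mem_FP (fanoutFn_mem_FP (nthF_mem_FP 0) (fanoutFn_mem_FP (comp_mem_FP fstF_mem_FP (nthF_mem_FP 1))
    (fanoutFn_mem_FP (fanoutFn_mem_FP (sndPow_mem_FP 1) (fanoutFn_mem_FP (comp_mem_FP fstF_mem_FP (nthF_mem_FP 1))
      (comp_mem_FP fstF_mem_FP (comp_mem_FP sndF_mem_FP (nthF_mem_FP 1))))) (comp_mem_FP sndF_mem_FP (comp_mem_FP sndF_mem_FP (nthF_mem_FP 1))))))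

/-- Semantics of `bRowItem`. [folklore] -/
theorem bRowItem_apply (x : List Bool) {n : ℕ} (hn : n ≤ x.length) (ents : List Bool) (i : ℕ) :
    bRowItem (boolPair x (boolPair (boolPair (encodeNat n) (boolPair ents (idxList n))) (ones i))) =
      rowCode (fun k : Fin n => capZ x.length (smval (elemOf ents (min (i * n + k) x.length)))) := by
  simp only [bRowItem, Function.comp_apply, fanoutFn_apply, nthF_zero_boolPair, nthF_succ_boolPair, sndPow_succ_boolPair,
    sndPow_zero, sndF_boolPair, fstF_boolPair]
  exact bRowF_apply x hn ents i

/-- `bRowItem` has absolutely bounded output. [folklore] -/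
theorem length_bRowItem_le (x p a : List Bool) :
    (bRowItem (boolPair x (boolPair p a))).length ≤ 0 * a.length + (X * (4 * X + 8) : Polynomial ℕ).eval x.length := by
  have := length_bRowF_le (boolPair x (boolPair (fstF p) (boolPair (boolPair a (boolPair (fstF p) (fstF (sndF p)))) (sndF (sndF p)))))
  simp only [bRowItem, Function.comp_apply, fanoutFn_apply, nthF_zero_boolPair, nthF_succ_boolPair, sndPow_succ_boolPair,
    sndPow_zero, sndF_boolPair, fstF_boolPair, eval_add, eval_mul, eval_ofNat, eval_X, zero_mul, zero_add] at this ⊢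
  exact this

/-- **The basis reader** on `⟨x, ⟨bin n, ⟨⟨bin n, ⟨ents, idxList n⟩⟩, idxList n⟩⟩⟩`: the canonical code of
the matrix `(i, k) ↦ smval ents[i n + k]` (capped, total). [folklore] -/
noncomputable def bMatF : List Bool → List Bool := mapLF bRowItem

/-- `bMatF ∈ FP`. [folklore] -/
theorem bMatF_mem_FP : bMatF ∈ FP := mapLF_mem_FP bRowItem_mem_FP (w := 0) (by norm_num) length_bRowItem_le

/-- Semantics of `bMatF` (`n ≤ |x|`). [folklore] -/
theorem bMatF_apply (x : List Bool) {n : ℕ} (hn : n ≤ x.length) (ents : List Bool) :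
    bMatF (boolPair x (boolPair (encodeNat n) (boolPair (boolPair (encodeNat n) (boolPair ents (idxList n))) (idxList n)))) =
      matCode (fun (i k : Fin n) => capZ x.length (smval (elemOf ents (min (i * n + k) x.length)))) := by
  rw [bMatF, mapLF_idxList _ _ _ hn, matCode,
    ofFn_eq_map_range (fun i => rowCode fun k : Fin n => capZ x.length (smval (elemOf ents (min (i * n + k) x.length))))]
  refine congrArg encList (List.map_congr_left fun i _ => ?_)
  rw [bRowItem_apply x hn]

/-- **On the instance**: with `ents = body (rowMajor n B)` and `n² ≤ |x|`, `|ents| ≤ |x|`, the basis reader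
returns `matCode B`. [folklore] -/
theorem bMatF_rowMajor (x : List Bool) {n : ℕ} (B : Matrix (Fin n) (Fin n) ℤ) (hn2 : n * n ≤ x.length)
    (hents : (body (rowMajor n B)).length ≤ x.length) :
    bMatF (boolPair x (boolPair (encodeNat n) (boolPair (boolPair (encodeNat n) (boolPair (body (rowMajor n B)) (idxList n))) (idxList n)))) =
      matCode (fun i k : Fin n => B i k) := by
  have hn : n ≤ x.length := le_trans (Nat.le_mul_self n) hn2
  rw [bMatF_apply x hn]
  refine congrArg matCode (funext fun i => funext fun k => ?_)
  have hlt : (i : ℕ) * n + k < n * n := by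
    have hi := i.isLt; have hk := k.isLt
    calc (i : ℕ) * n + k < i * n + n := by omega
      _ = (i + 1) * n := by ring
      _ ≤ n * n := Nat.mul_le_mul_right _ (by omega)
  rw [min_eq_left (by omega), capZ_smval_elemOf hents, smval_elemOf_rowMajor B i k]

/-- The entry item of the target reader on `⟨x, ⟨tents, 1ˡ⟩⟩`. [folklore] -/
noncomputable def tItem : List Bool → List Bool :=
  zcapF ∘ fanoutFn (nthF 0) (zcanonF ∘ ofSMFn ∘ elemFn ∘ fanoutFn (sndPow 1) (nthF 1))

/-- `tItem ∈ FP`. [folklore] -/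
theorem tItem_mem_FP : tItem ∈ FP :=
  comp_mem_FP zcapF_mem_FP (fanoutFn_mem_FP (nthF_mem_FP 0) (comp_mem_FP zcanonF_mem_FP (comp_mem_FP ofSMFn_mem_FP
    (comp_mem_FP elemFn_mem_FP (fanoutFn_mem_FP (sndPow_mem_FP 1) (nthF_mem_FP 1))))))

/-- Semantics of `tItem`. [folklore] -/
theorem tItem_apply (x tents a : List Bool) :
    tItem (boolPair x (boolPair tents a)) = dpEnc (capZ x.length (smval (elemOf tents a.length))) := by
  simp only [tItem, Function.comp_apply, fanoutFn_apply, nthF_zero_boolPair, nthF_succ_boolPair, sndPow_succ_boolPair,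
    sndPow_zero, sndF_boolPair, elemFn_boolPair, zcanonF_eq, ival_ofSMFn]
  rw [zcapF_dpEnc, capZ]

/-- `tItem` saturates. [folklore] -/
theorem length_tItem_le (x p a : List Bool) :
    (tItem (boolPair x (boolPair p a))).length ≤ 0 * a.length + (2 * X + 2 : Polynomial ℕ).eval x.length := by
  have := length_zcapF_le (boolPair x (zcanonF (ofSMFn (elemFn (boolPair a p)))))
  simp only [tItem, Function.comp_apply, fanoutFn_apply, nthF_zero_boolPair, nthF_succ_boolPair, sndPow_succ_boolPair,
    sndPow_zero, sndF_boolPair, fstF_boolPair, eval_add, eval_mul, eval_ofNat, eval_X, zero_mul, zero_add] at this ⊢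
  exact this

/-- **The target reader** on `⟨x, ⟨bin n, ⟨tents, idxList n⟩⟩⟩`: the canonical code of
`(smval tents[0], …, smval tents[n-1])`. [folklore] -/
noncomputable def tRowF : List Bool → List Bool := mapLF tItem

/-- `tRowF ∈ FP`. [folklore] -/
theorem tRowF_mem_FP : tRowF ∈ FP := mapLF_mem_FP tItem_mem_FP (w := 0) (by norm_num) length_tItem_le

/-- Semantics of `tRowF` (`n ≤ |x|`). [folklore] -/
theorem tRowF_apply (x : List Bool) {n : ℕ} (hn : n ≤ x.length) (tents : List Bool) :
    tRowF (boolPair x (boolPair (encodeNat n) (boolPair tents (idxList n)))) =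
      rowCode (fun l : Fin n => capZ x.length (smval (elemOf tents l))) := by
  rw [tRowF, mapLF_idxList _ _ _ hn, rowCode_eq_map_range _ (fun l => capZ x.length (smval (elemOf tents l))) (fun l => rfl)]
  refine congrArg encList (List.map_congr_left fun l _ => ?_)
  rw [tItem_apply, List.length_replicate]

/-- **On the instance**: with `tents = frames (codes of t)` short, the target reader returns `rowCode t`.
[folklore] -/
theorem tRowF_frames (x : List Bool) {n : ℕ} (hn : n ≤ x.length) (t : Fin n → ℤ)
    (ht : (frames (List.ofFn fun k => encodingIntBool.encode (t k))).length ≤ x.length) :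
    tRowF (boolPair x (boolPair (encodeNat n) (boolPair (frames (List.ofFn fun k => encodingIntBool.encode (t k))) (idxList n)))) =
      rowCode t := by
  rw [tRowF_apply x hn]
  refine congrArg rowCode (funext fun l => ?_)
  rw [capZ_smval_elemOf ht, frames_eq_encList, elemOf_encList, List.getD_eq_getElem _ _ (by simp), List.getElem_ofFn,
    smval_encode]

/-- Length of `tRowF`: absolute. [folklore] -/
theorem length_tRowF_le (z : List Bool) : (tRowF z).length ≤ (fstF z).length * (4 * (fstF z).length + 8) := by
  have h := length_mapLF_le (f := tItem) 0 (P := 2 * X + 2) length_tItem_le z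
  simp only [zero_mul, zero_add, eval_add, eval_mul, eval_ofNat, eval_X] at h
  rw [tRowF]
  nlinarith

end FarCertMachine

end Literature.Algebra.EuclideanLattices
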